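import Mathlib

/-!
# Crux `MatrixDescartes` (stmt-ValiantsHypothesis-18050), line `Lift` — registered stub `stub_inertiaChain`

The linear-algebra heart ("inertia chain") of the first rung of the line: a Loewner
non-decreasing family `G : ℝ → Matrix ι ι ℝ` of real symmetric matrices admits at most
`Fintype.card ι` kernel events of the following kind: times `0 < τ 0 < τ 1 < ⋯ < τ (k - 1)` and
vectors `v j` with `G (τ j) *ᵥ v j = 0` whose quadratic form `v j ⬝ᵥ (G s *ᵥ v j)` is strictly
positive at every later time `s > τ j`.

## Proof

We show that the family `v` is linearly independent, whence
`k = card (Fin k) ≤ finrank ℝ (ι → ℝ) = card ι`.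
Linear independence follows from the quantitative statement
`StubInertiaChain.quadForm_sum_pos`, proved by induction on `k`: for every coefficient vector
`c : Fin k → ℝ` with some nonzero entry and every time `s` exceeding all the `τ j`, the quadratic
form of `G s` is strictly positive at `∑ i, c i • v i` (so this sum cannot vanish).
In the induction step write `∑ i, c i • v i = u + a • y` with `y := v (Fin.last n)`,
`a := c (Fin.last n)` and `u` the sum over the earlier indices, and let `T := τ (Fin.last n)`.
At the kernel time `T` the cross terms vanish (`G T *ᵥ y = 0` and `G T` is symmetric), so the
quadratic form of `G T` at `u + a • y` equals the one at `u`; the latter is positive by the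
induction hypothesis whenever some earlier coefficient is nonzero, because all earlier times are
`< T` by strict monotonicity of `τ`. Loewner monotonicity (`G s - G T` positive semidefinite for
`0 < T ≤ s`) transfers positivity from time `T` to time `s`. If all earlier coefficients vanish,
then `u = 0`, `a ≠ 0`, and the quadratic form equals `a * a * (y ⬝ᵥ (G s *ᵥ y)) > 0` by the
positivity hypothesis at `s > T`.

Elementary; Mathlib only (axioms `propext`, `Classical.choice`, `Quot.sound`).
-/

-- layout Summits/ValiantsHypothesis/ValiantsHypothesis forces the duplicated namespace component
set_option linter.dupNamespace false

namespace Summit.ValiantsHypothesis.ValiantsHypothesis.Theorems.LacunarySymmetroidMatrixDescartes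

open Matrix Finset
open scoped BigOperators

namespace StubInertiaChain

/-- For a real symmetric matrix `A`, the bilinear form `(x, y) ↦ x ⬝ᵥ (A *ᵥ y)` is symmetric. -/
theorem dotProduct_mulVec_comm {ι : Type*} [Fintype ι] {A : Matrix ι ι ℝ} (hA : A.IsSymm)
    (x y : ι → ℝ) : x ⬝ᵥ (A *ᵥ y) = y ⬝ᵥ (A *ᵥ x) := by
  rw [dotProduct_mulVec, ← mulVec_transpose, hA.eq, dotProduct_comm]

/-- If `A` is real symmetric and `y` lies in the kernel of `A`, then the quadratic form of `A` at
`u + a • y` equals the quadratic form at `u`: the cross terms and the `y`-term vanish. -/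
theorem quadForm_add_smul_of_mulVec_eq_zero {ι : Type*} [Fintype ι] {A : Matrix ι ι ℝ}
    (hA : A.IsSymm) {y : ι → ℝ} (hy : A *ᵥ y = 0) (u : ι → ℝ) (a : ℝ) :
    (u + a • y) ⬝ᵥ (A *ᵥ (u + a • y)) = u ⬝ᵥ (A *ᵥ u) := by
  rw [mulVec_add, mulVec_smul, hy, smul_zero, add_zero, add_dotProduct, smul_dotProduct,
    dotProduct_mulVec_comm hA y u, hy, dotProduct_zero, smul_zero, add_zero]

/-- The quadratic form at a scalar multiple:
`(a • y) ⬝ᵥ (A *ᵥ (a • y)) = a * a * (y ⬝ᵥ (A *ᵥ y))`. -/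
theorem quadForm_smul {ι : Type*} [Fintype ι] (A : Matrix ι ι ℝ) (y : ι → ℝ) (a : ℝ) :
    (a • y) ⬝ᵥ (A *ᵥ (a • y)) = a * a * (y ⬝ᵥ (A *ᵥ y)) := by
  rw [mulVec_smul, smul_dotProduct, dotProduct_smul, smul_eq_mul, smul_eq_mul, mul_assoc]

/-- Loewner monotonicity of the quadratic form: if `B - A` is positive semidefinite, then
`w ⬝ᵥ (A *ᵥ w) ≤ w ⬝ᵥ (B *ᵥ w)` for every `w`. -/
theorem quadForm_mono {ι : Type*} [Fintype ι] {A B : Matrix ι ι ℝ} (h : (B - A).PosSemidef)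
    (w : ι → ℝ) : w ⬝ᵥ (A *ᵥ w) ≤ w ⬝ᵥ (B *ᵥ w) := by
  have h0 := h.dotProduct_mulVec_nonneg w
  rw [star_trivial, sub_mulVec, dotProduct_sub, sub_nonneg] at h0
  exact h0

/-- **The induction step of the inertia chain.** Let `A` (the matrix at the kernel time) be real
symmetric with `A *ᵥ y = 0`, let `B` (the matrix at a later time) satisfy `B - A` positive
semidefinite and `0 < y ⬝ᵥ (B *ᵥ y)`. If either the quadratic form of `A` is strictly positive
at `u`, or `u = 0` and `a ≠ 0`, then the quadratic form of `B` is strictly positive at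
`u + a • y`. -/
theorem step {ι : Type*} [Fintype ι] {A B : Matrix ι ι ℝ} (hA : A.IsSymm)
    (hAB : (B - A).PosSemidef) {y : ι → ℝ} (hy : A *ᵥ y = 0) (hyB : 0 < y ⬝ᵥ (B *ᵥ y))
    {u : ι → ℝ} {a : ℝ} (h : 0 < u ⬝ᵥ (A *ᵥ u) ∨ (u = 0 ∧ a ≠ 0)) :
    0 < (u + a • y) ⬝ᵥ (B *ᵥ (u + a • y)) := by
  rcases h with hu | ⟨rfl, ha⟩
  · calc (0 : ℝ) < u ⬝ᵥ (A *ᵥ u) := hu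
      _ = (u + a • y) ⬝ᵥ (A *ᵥ (u + a • y)) :=
        (quadForm_add_smul_of_mulVec_eq_zero hA hy u a).symm
      _ ≤ (u + a • y) ⬝ᵥ (B *ᵥ (u + a • y)) := quadForm_mono hAB _
  · rw [zero_add, quadForm_smul]
    exact mul_pos (mul_self_pos.2 ha) hyB

/-- **Inertia chain, quantitative form.** Let `G : ℝ → Matrix ι ι ℝ` be a family of real
symmetric matrices, Loewner non-decreasing on `(0, ∞)`, and let `τ : Fin k → ℝ` be strictly
increasing positive times with vectors `v j` such that `G (τ j) *ᵥ v j = 0` and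
`0 < v j ⬝ᵥ (G s *ᵥ v j)` for all `s > τ j`. Then for every coefficient vector `c : Fin k → ℝ`
with some nonzero entry and every time `s` with `τ j < s` for all `j`, the quadratic form of
`G s` is strictly positive at `∑ i, c i • v i`. -/
theorem quadForm_sum_pos {ι : Type*} [Fintype ι] (G : ℝ → Matrix ι ι ℝ)
    (hG : ∀ s, (G s).IsSymm) (hmono : ∀ s t : ℝ, 0 < s → s ≤ t → (G t - G s).PosSemidef) :
    ∀ (k : ℕ) (τ : Fin k → ℝ) (v : Fin k → (ι → ℝ)), StrictMono τ → (∀ j, 0 < τ j) →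
      (∀ j, G (τ j) *ᵥ v j = 0) → (∀ j (s : ℝ), τ j < s → 0 < v j ⬝ᵥ (G s *ᵥ v j)) →
      ∀ c : Fin k → ℝ, (∃ i, c i ≠ 0) → ∀ s : ℝ, (∀ j, τ j < s) →
        0 < (∑ i, c i • v i) ⬝ᵥ (G s *ᵥ ∑ i, c i • v i)
  | 0, _, _, _, _, _, _, _, ⟨i, _⟩, _, _ => i.elim0
  | k + 1, τ, v, hτ, hτpos, hker, hpos, c, hc, s, hs => by
    -- split off the last index: `∑ i, c i • v i = u + a • y`
    have hsplit : ∑ i, c i • v i =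
        (∑ i : Fin k, c (Fin.castSucc i) • v (Fin.castSucc i))
          + c (Fin.last k) • v (Fin.last k) :=
      Fin.sum_univ_castSucc _
    rw [hsplit]
    refine step (hG (τ (Fin.last k))) (hmono (τ (Fin.last k)) s (hτpos _) (hs _).le)
      (hker (Fin.last k)) (hpos (Fin.last k) s (hs _)) ?_
    by_cases hc' : ∃ i : Fin k, c (Fin.castSucc i) ≠ 0
    · -- some earlier coefficient is nonzero: induction hypothesis at the kernel time
      -- `τ (Fin.last k)`, which exceeds all the earlier times by strict monotonicity of `τ`
      exact Or.inl (quadForm_sum_pos G hG hmono k (fun i => τ (Fin.castSucc i))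
        (fun i => v (Fin.castSucc i)) (hτ.comp Fin.strictMono_castSucc)
        (fun j => hτpos (Fin.castSucc j)) (fun j => hker (Fin.castSucc j))
        (fun j => hpos (Fin.castSucc j)) (fun i => c (Fin.castSucc i)) hc' (τ (Fin.last k))
        fun j => hτ (Fin.castSucc_lt_last j))
    · -- all earlier coefficients vanish: `u = 0` and `a ≠ 0`
      push Not at hc'
      refine Or.inr ⟨Finset.sum_eq_zero fun i _ => by rw [hc' i, zero_smul], fun ha => ?_⟩
      obtain ⟨i, hi⟩ := hc
      rcases Fin.eq_castSucc_or_eq_last i with ⟨j, rfl⟩ | rfl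
      · exact hi (hc' j)
      · exact hi ha

end StubInertiaChain

/-- **Registered stub `stub_inertiaChain`** (inertia chain). Let `G : ℝ → Matrix ι ι ℝ` be a
family of real symmetric matrices which is Loewner non-decreasing on `(0, ∞)`
(`G t - G s` positive semidefinite for `0 < s ≤ t`). Suppose `τ : Fin k → ℝ` is a strictly
increasing family of positive times and `v : Fin k → (ι → ℝ)` are vectors with
`G (τ j) *ᵥ v j = 0` and `0 < v j ⬝ᵥ (G s *ᵥ v j)` for every `s > τ j`. Then `k ≤ card ι`:
indeed the `v j` are linearly independent (`StubInertiaChain.quadForm_sum_pos`). -/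
theorem stub_inertiaChain (ι : Type) [Fintype ι] [DecidableEq ι] (G : ℝ → Matrix ι ι ℝ)
    (hG : ∀ s, (G s).IsSymm) (hmono : ∀ s t : ℝ, 0 < s → s ≤ t → (G t - G s).PosSemidef)
    (k : ℕ) (τ : Fin k → ℝ) (hτ : StrictMono τ) (hτpos : ∀ j, 0 < τ j) (v : Fin k → (ι → ℝ))
    (hker : ∀ j, G (τ j) *ᵥ v j = 0) (hpos : ∀ j (s : ℝ), τ j < s → 0 < v j ⬝ᵥ (G s *ᵥ v j)) :
    k ≤ Fintype.card ι := by
  -- the family `v` is linearly independent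
  have hli : LinearIndependent ℝ v := by
    rw [Fintype.linearIndependent_iff]
    intro c hc0
    by_contra hne
    push Not at hne
    -- a time beyond all the kernel times
    have hs : ∀ j, τ j < (∑ i, τ i) + 1 := fun j =>
      (Finset.single_le_sum (fun i _ => (hτpos i).le) (Finset.mem_univ j)).trans_lt
        (lt_add_one _)
    have h := StubInertiaChain.quadForm_sum_pos G hG hmono k τ v hτ hτpos hker hpos c hne _ hs
    rw [hc0, zero_dotProduct] at h
    exact lt_irrefl 0 h
  have h := hli.fintype_card_le_finrank
  rwa [Fintype.card_fin, Module.finrank_fintype_fun_eq_card] at h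

end Summit.ValiantsHypothesis.ValiantsHypothesis.Theorems.LacunarySymmetroidMatrixDescartes
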